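/-
Copyright (c) 2026 the pub-hodgecm-mathlib formalisation cell (harness21).  Prover seat hodgecm-mathlib-K2E1-p12 (g0), Track B ∕ K2-LIT, h413 = `stmt-HodgeConjecture-24833`,
line `K2_E1_TraceFormulaBeta`, campaign «R8₂-sph EXHAUSTION», ROADCARD row T4 (dealer K2E1-plan (g6) deals (104)∕(122)∕(124)) FILE T4a: the Mathlib-only complex analysis of the
contour shift between two vertical lines, with one simple pole in between.
-/
import Mathlib.Analysis.Complex.CauchyIntegral
import Mathlib.Analysis.Complex.RemovableSingularity
import Mathlib.Analysis.SpecialFunctions.ImproperIntegrals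
import Mathlib.MeasureTheory.Integral.IntegralEqImproper
import Mathlib.MeasureTheory.Measure.Haar.NormedSpace
import Mathlib.MeasureTheory.Group.Integral
import HarnessLib

/-!
# T4a — `K2E1VerticalLineContourShift`: moving a vertical line integral `∫_ℝ F(σ₂+iy) dy` to `∫_ℝ F(σ₁+iy) dy` across a simple pole at `z = 1`
# (`∫_ℝ F(σ₂+iy) dy = ∫_ℝ F(σ₁+iy) dy + 2π·Res_{z=1} F`), Mathlib-only

Track B ∕ K2-LIT, crux h413 = `stmt-HodgeConjecture-24833`, route of record `HCCMUnconditional`; cell `hodgecm-mathlib`, squad K2, ENGINE E1.  THEOREMS ONLY (no `def`, no `instance`,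
no `notation`, no `sorry`; default heartbeats); lane `--supports stmt-HodgeConjecture-24833 --as helper` (count-neutral).  GENERIC complex analysis, no automorphic object.

THE MATHEMATICS ([Titchmarsh1939, §3.12 (rectangle∕residue book-keeping)]; [MoeglinWaldspurger1995, II.2.1–II.2.4 (where it is used: the contour shift of the inner product
formula for pseudo-Eisenstein series)]).  Mathlib has Cauchy's theorem for rectangles (`Complex.integral_boundary_rect_eq_zero_of_differentiableOn`) and the removable
singularity theorem, but neither the passage «rectangle → pair of vertical lines» nor a residue theorem; this file supplies exactly the rank-one book-keeping the road needs.
§1 THE PRINCIPAL-PART KERNEL `k(z) = 2∕((z−1)(z+1))` (simple pole at `1` with residue `1`, the companion pole `−1` to the LEFT of every strip used): its vertical line integrals in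
closed form, from **`integral_inv_vertical_mul_vertical`**: `∫_ℝ dy∕((α+iy)(β+iy)) = π(sgn α − sgn β)∕(β−α)` (`α, β ≠ 0`, `α ≠ β`; real part by partial fractions and
`∫ α∕(α²+y²) = π·sgn α`, imaginary part odd), whence `∫_ℝ k(σ+iy) dy = 0` for `σ > 1` and `= −2π` for `−1 < σ < 1`.
§2 THE HOLOMORPHIC SHIFT **`integral_vertical_eq_of_differentiableOn`**: `G` holomorphic on the closed strip `σ₁ ≤ Re z ≤ σ₂`, integrable on both boundary lines, horizontal
integrals `∫_{σ₁}^{σ₂} G(x ± iT) dx → 0` ⇒ `∫_ℝ G(σ₂+iy) dy = ∫_ℝ G(σ₁+iy) dy` (Cauchy on `[σ₁,σ₂]×[−T,T]`, `T → ∞` by `intervalIntegral_tendsto_integral`); the horizontal hypothesis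
from a uniform bound `‖G(x+iy)‖ ≤ K∕y²` (`tendsto_intervalIntegral_horizontal_of_sq_decay`), and vertical integrability from continuity + the same decay
(`integrable_of_continuous_of_sq_decay`).
§3 THE SIMPLE POLE **`integral_vertical_eq_integral_vertical_add_residue`**: `F` holomorphic on an open neighbourhood of the closed strip except at `z = 1` (`−1 < σ₁ < 1 < σ₂`),
`(z−1)F(z) → ρ`, integrable on both lines, `‖F(x+iy)‖ ≤ K∕y²` for `|y| ≥ 1` uniformly in `x` ⇒ **`∫_ℝ F(σ₂+iy) dy = ∫_ℝ F(σ₁+iy) dy + 2πρ`** — `G := F − ρ·k` has a removable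
singularity at `1` (`G = dslope N 1`, `N = (z−1)F − 2ρ∕(z+1)`, Mathlib `differentiableOn_compl_singleton_and_continuousAt_iff`, `differentiableOn_dslope`), §2 shifts `G`, §1 evaluates
the kernel's two line integrals.  Equivalently `(2π)⁻¹∫F(σ₂+iy) = (2π)⁻¹∫F(σ₁+iy) + Res_{z=1}F`.
HONEST LABEL: HC_CM is proved only modulo the 7 printed citations (2 remaining named inputs: hLiu418 = `stmt-HodgeConjecture-24832`, h413 = `stmt-HodgeConjecture-24833`) until rung 0
closes; this file asserts no named fact, closes no socket; count-neutral; letter-free, Mathlib-only.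

## References
* [Titchmarsh1939] E. C. Titchmarsh, *The Theory of Functions* (2nd ed., 1939), §3.1 (Cauchy's residue theorem), §3.12.
* [MoeglinWaldspurger1995] C. Mœglin, J.-L. Waldspurger, *Spectral decomposition and Eisenstein series* (1995), II.2.1–II.2.4.
-/

set_option autoImplicit false
set_option linter.dupNamespace false  -- the mandated namespace repeats the summit's segment (`HodgeConjecture.HodgeConjecture`)

noncomputable section

open MeasureTheory Measure Set Filter Topology Complex
open scoped Real ComplexConjugate

namespace Summit.HodgeConjecture.HodgeConjecture.Cruxes.H413.K2E1VerticalLineContourShift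

/-! ## §1 The principal-part kernel: `∫_ℝ dy∕((α+iy)(β+iy))` in closed form, and the two line integrals of `k(z) = 2∕((z−1)(z+1))` -/

/-- `∫_ℝ α∕(α² + y²) dy = π·sgn α` (`α ≠ 0`; substitution `y = α u`, Mathlib `integral_univ_inv_one_add_sq`). [folklore] -/
theorem integral_div_sq_add_sq {α : ℝ} (hα : α ≠ 0) : ∫ y : ℝ, α / (α ^ 2 + y ^ 2) = π * (|α| / α) := by
  have h : (fun y : ℝ => α / (α ^ 2 + y ^ 2)) = fun y => α⁻¹ * (1 + (y / α) ^ 2)⁻¹ := by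
    funext y
    have : α ^ 2 + y ^ 2 ≠ 0 := by positivity
    field_simp
  rw [h, MeasureTheory.integral_const_mul, Measure.integral_comp_div (fun u : ℝ => (1 + u ^ 2)⁻¹) α, integral_univ_inv_one_add_sq, smul_eq_mul]
  field_simp

/-- `y ↦ α∕(α² + y²)` is integrable (`α ≠ 0`). [folklore] -/
theorem integrable_div_sq_add_sq {α : ℝ} (hα : α ≠ 0) : Integrable fun y : ℝ => α / (α ^ 2 + y ^ 2) := by
  have h : (fun y : ℝ => α / (α ^ 2 + y ^ 2)) = fun y => α⁻¹ * (1 + (y / α) ^ 2)⁻¹ := by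
    funext y
    have : α ^ 2 + y ^ 2 ≠ 0 := by positivity
    field_simp
  rw [h]
  exact (integrable_inv_one_add_sq.comp_div hα).const_mul _

/-- `(α+iy)(β+iy) ≠ 0` for real `α, β ≠ 0`. [folklore] -/
theorem vertical_mul_vertical_ne_zero {α β : ℝ} (hα : α ≠ 0) (hβ : β ≠ 0) (y : ℝ) : ((α : ℂ) + y * I) * ((β : ℂ) + y * I) ≠ 0 :=
  mul_ne_zero (fun h => hα (by simpa using congrArg Complex.re h)) (fun h => hβ (by simpa using congrArg Complex.re h))

/-- Real part of `1∕((α+iy)(β+iy))` in partial-fraction form: `(αβ − y²)∕((α²+y²)(β²+y²)) = (α∕(α²+y²) − β∕(β²+y²))∕(β − α)`. [folklore] -/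
theorem re_inv_vertical_mul_vertical {α β : ℝ} (hα : α ≠ 0) (hβ : β ≠ 0) (hαβ : α ≠ β) (y : ℝ) :
    ((((α : ℂ) + y * I) * ((β : ℂ) + y * I))⁻¹).re = (β - α)⁻¹ * (α / (α ^ 2 + y ^ 2) - β / (β ^ 2 + y ^ 2)) := by
  have h3 : β - α ≠ 0 := sub_ne_zero.2 (Ne.symm hαβ)
  have hy : α ^ 2 + y ^ 2 ≠ 0 := by positivity
  have hy' : β ^ 2 + y ^ 2 ≠ 0 := by positivity
  rw [inv_re, normSq_mul, normSq_add_mul_I, normSq_add_mul_I]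
  simp only [mul_re, add_re, ofReal_re, mul_im, ofReal_im, I_re, I_im, add_im, mul_zero, mul_one, zero_add, add_zero, sub_zero]
  field_simp
  ring

/-- Imaginary part of `1∕((α+iy)(β+iy))`: `−(α+β)y∕((α²+y²)(β²+y²))`, an ODD function of `y`. [folklore] -/
theorem im_inv_vertical_mul_vertical (α β y : ℝ) :
    ((((α : ℂ) + y * I) * ((β : ℂ) + y * I))⁻¹).im = -((α + β) * y) / ((α ^ 2 + y ^ 2) * (β ^ 2 + y ^ 2)) := by
  rw [inv_im, normSq_mul, normSq_add_mul_I, normSq_add_mul_I]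
  simp only [mul_re, add_re, ofReal_re, mul_im, ofReal_im, I_re, I_im, add_im, mul_zero, mul_one, zero_add, add_zero, sub_zero]
  ring

/-- `y ↦ 1∕((α+iy)(β+iy))` is integrable on `ℝ` for `α, β ≠ 0` (continuous, `≤ 1∕(m²+y²)`, `m = min |α| |β|`). [folklore] -/
theorem integrable_inv_vertical_mul_vertical {α β : ℝ} (hα : α ≠ 0) (hβ : β ≠ 0) :
    Integrable fun y : ℝ => (((α : ℂ) + y * I) * ((β : ℂ) + y * I))⁻¹ := by
  set m : ℝ := min |α| |β| with hm
  have hm0 : 0 < m := lt_min (abs_pos.2 hα) (abs_pos.2 hβ)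
  have hfc : Continuous fun y : ℝ => (((α : ℂ) + y * I) * ((β : ℂ) + y * I))⁻¹ :=
    ((continuous_const.add (continuous_ofReal.mul continuous_const)).mul (continuous_const.add (continuous_ofReal.mul continuous_const))).inv₀
      (vertical_mul_vertical_ne_zero hα hβ)
  refine Integrable.mono' ((integrable_inv_one_add_sq.comp_div hm0.ne').const_mul (m ^ 2)⁻¹) hfc.aestronglyMeasurable (Eventually.of_forall fun y => ?_)
  rw [norm_inv, norm_mul, norm_add_mul_I, norm_add_mul_I]
  have hαm : m ^ 2 ≤ α ^ 2 := by
    have h := pow_le_pow_left₀ hm0.le (min_le_left |α| |β|) 2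
    rwa [sq_abs] at h
  have hβm : m ^ 2 ≤ β ^ 2 := by
    have h := pow_le_pow_left₀ hm0.le (min_le_right |α| |β|) 2
    rwa [sq_abs] at h
  have hprod : m ^ 2 + y ^ 2 ≤ √(α ^ 2 + y ^ 2) * √(β ^ 2 + y ^ 2) := by
    have ha : √(m ^ 2 + y ^ 2) ≤ √(α ^ 2 + y ^ 2) := Real.sqrt_le_sqrt (by linarith)
    have hb : √(m ^ 2 + y ^ 2) ≤ √(β ^ 2 + y ^ 2) := Real.sqrt_le_sqrt (by linarith)
    calc m ^ 2 + y ^ 2 = √(m ^ 2 + y ^ 2) * √(m ^ 2 + y ^ 2) := (Real.mul_self_sqrt (by positivity)).symm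
      _ ≤ √(α ^ 2 + y ^ 2) * √(β ^ 2 + y ^ 2) := mul_le_mul ha hb (Real.sqrt_nonneg _) (Real.sqrt_nonneg _)
  have hpos : 0 < m ^ 2 + y ^ 2 := by positivity
  calc (√(α ^ 2 + y ^ 2) * √(β ^ 2 + y ^ 2))⁻¹ ≤ (m ^ 2 + y ^ 2)⁻¹ := inv_anti₀ hpos hprod
    _ = (m ^ 2)⁻¹ * (1 + (y / m) ^ 2)⁻¹ := by
        have hm2 : m ^ 2 ≠ 0 := by positivity
        have hm1 : m ≠ 0 := hm0.ne'
        field_simp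

/-- **`∫_ℝ dy∕((α+iy)(β+iy)) = (π·sgn α − π·sgn β)∕(β − α)`** for real `α, β ≠ 0`, `α ≠ β` (`sgn t = |t|∕t`): real part by partial fractions and `integral_div_sq_add_sq`, imaginary
part odd hence `0`.  For `α = σ−1`, `β = σ+1`: `0` if `σ > 1`, `−π` if `−1 < σ < 1`. [cite: Titchmarsh1939, §3.12] -/
theorem integral_inv_vertical_mul_vertical {α β : ℝ} (hα : α ≠ 0) (hβ : β ≠ 0) (hαβ : α ≠ β) :
    ∫ y : ℝ, (((α : ℂ) + y * I) * ((β : ℂ) + y * I))⁻¹ = (((π * (|α| / α) - π * (|β| / β)) / (β - α) : ℝ) : ℂ) := by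
  set f : ℝ → ℂ := fun y => (((α : ℂ) + y * I) * ((β : ℂ) + y * I))⁻¹ with hf
  have hfi : Integrable f := integrable_inv_vertical_mul_vertical hα hβ
  -- real part
  have hre : (∫ y, f y).re = (π * (|α| / α) - π * (|β| / β)) / (β - α) := by
    have h1 : (∫ y, f y).re = ∫ y, (f y).re := by
      have h := integral_re hfi
      simp only [RCLike.re_to_complex] at h
      exact h.symm
    rw [h1]
    simp only [hf, re_inv_vertical_mul_vertical hα hβ hαβ]
    rw [MeasureTheory.integral_const_mul, integral_sub (integrable_div_sq_add_sq hα) (integrable_div_sq_add_sq hβ), integral_div_sq_add_sq hα, integral_div_sq_add_sq hβ]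
    ring
  -- imaginary part: odd integrand
  have him : (∫ y, f y).im = 0 := by
    have h1 : (∫ y, f y).im = ∫ y, (f y).im := by
      have h := integral_im hfi
      simp only [RCLike.im_to_complex] at h
      exact h.symm
    rw [h1]
    have hodd : (fun y : ℝ => (f (-y)).im) = fun y => -(f y).im := by
      funext y
      simp only [hf, ofReal_neg, neg_mul]
      rw [show (α : ℂ) + -((y : ℂ) * I) = (α : ℂ) + ((-y : ℝ) : ℂ) * I by push_cast; ring,
        show (β : ℂ) + -((y : ℂ) * I) = (β : ℂ) + ((-y : ℝ) : ℂ) * I by push_cast; ring,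
        im_inv_vertical_mul_vertical, im_inv_vertical_mul_vertical]
      ring
    have h2 := integral_neg_eq_self (fun y : ℝ => (f y).im) volume
    rw [hodd, MeasureTheory.integral_neg] at h2
    linarith
  apply Complex.ext
  · rw [hre, ofReal_re]
  · rw [him, ofReal_im]

/-- **`∫_ℝ k(σ+iy) dy = 0` for `σ > 1`**, `k(z) = 2∕((z−1)(z+1))` (both poles to the left of the line). [cite: Titchmarsh1939, §3.12] -/
theorem integral_kernel_vertical_of_one_lt {σ : ℝ} (hσ : 1 < σ) :
    ∫ y : ℝ, 2 * ((((σ : ℂ) + y * I) - 1) * (((σ : ℂ) + y * I) + 1))⁻¹ = 0 := by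
  have hα : σ - 1 ≠ 0 := by linarith
  have hβ : σ + 1 ≠ 0 := by linarith
  have h : (fun y : ℝ => 2 * ((((σ : ℂ) + y * I) - 1) * (((σ : ℂ) + y * I) + 1))⁻¹) =
      fun y : ℝ => 2 * ((((σ - 1 : ℝ) : ℂ) + y * I) * (((σ + 1 : ℝ) : ℂ) + y * I))⁻¹ := by
    funext y; push_cast; ring_nf
  rw [h, MeasureTheory.integral_const_mul, integral_inv_vertical_mul_vertical hα hβ (by linarith), abs_of_pos (by linarith : 0 < σ - 1), abs_of_pos (by linarith : 0 < σ + 1),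
    div_self hα, div_self hβ, sub_self, zero_div, ofReal_zero, mul_zero]

/-- **`∫_ℝ k(σ+iy) dy = −2π` for `−1 < σ < 1`**, `k(z) = 2∕((z−1)(z+1))` (the pole `1` to the right, `−1` to the left of the line). [cite: Titchmarsh1939, §3.12] -/
theorem integral_kernel_vertical_of_lt_one {σ : ℝ} (hσ : -1 < σ) (hσ' : σ < 1) :
    ∫ y : ℝ, 2 * ((((σ : ℂ) + y * I) - 1) * (((σ : ℂ) + y * I) + 1))⁻¹ = -2 * π := by
  have hα : σ - 1 ≠ 0 := by linarith
  have hβ : σ + 1 ≠ 0 := by linarith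
  have h : (fun y : ℝ => 2 * ((((σ : ℂ) + y * I) - 1) * (((σ : ℂ) + y * I) + 1))⁻¹) =
      fun y : ℝ => 2 * ((((σ - 1 : ℝ) : ℂ) + y * I) * (((σ + 1 : ℝ) : ℂ) + y * I))⁻¹ := by
    funext y; push_cast; ring_nf
  rw [h, MeasureTheory.integral_const_mul, integral_inv_vertical_mul_vertical hα hβ (by linarith), abs_of_neg (by linarith : σ - 1 < 0), abs_of_pos (by linarith : 0 < σ + 1),
    div_self hβ, neg_div, div_self hα]
  push_cast
  have h2 : ((σ : ℂ) + 1 - (σ - 1)) = 2 := by ring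
  rw [h2]
  ring

/-- The kernel is integrable on every vertical line `Re z = σ`, `σ ≠ ±1`. [folklore] -/
theorem integrable_kernel_vertical {σ : ℝ} (hσ : σ ≠ 1) (hσ' : σ ≠ -1) :
    Integrable fun y : ℝ => 2 * ((((σ : ℂ) + y * I) - 1) * (((σ : ℂ) + y * I) + 1))⁻¹ := by
  have hα : σ - 1 ≠ 0 := sub_ne_zero.2 hσ
  have hβ : σ + 1 ≠ 0 := fun h => hσ' (by linarith)
  have h : (fun y : ℝ => 2 * ((((σ : ℂ) + y * I) - 1) * (((σ : ℂ) + y * I) + 1))⁻¹) =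
      fun y : ℝ => 2 * ((((σ - 1 : ℝ) : ℂ) + y * I) * (((σ + 1 : ℝ) : ℂ) + y * I))⁻¹ := by
    funext y; push_cast; ring_nf
  rw [h]
  exact (integrable_inv_vertical_mul_vertical hα hβ).const_mul _

/-! ## §2 The holomorphic shift between two vertical lines -/

/-- **HOLOMORPHIC CONTOUR SHIFT BETWEEN VERTICAL LINES.**  `σ₁ ≤ σ₂`, `G` complex-differentiable on the closed strip `{σ₁ ≤ Re z ≤ σ₂}`, `y ↦ G(σᵢ+iy)` integrable (`i = 1,2`), and the
horizontal integrals `∫_{σ₁}^{σ₂} G(x+iT) dx`, `∫_{σ₁}^{σ₂} G(x−iT) dx → 0` as `T → +∞`: then **`∫_ℝ G(σ₂+iy) dy = ∫_ℝ G(σ₁+iy) dy`** — Cauchy's theorem on the rectangle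
`[σ₁,σ₂]×[−T,T]` (Mathlib `integral_boundary_rect_eq_zero_of_differentiableOn`) and `T → ∞` (Mathlib `intervalIntegral_tendsto_integral`). [cite: Titchmarsh1939, §3.12] -/
theorem integral_vertical_eq_of_differentiableOn {G : ℂ → ℂ} {σ₁ σ₂ : ℝ} (hσ : σ₁ ≤ σ₂) (hG : DifferentiableOn ℂ G {z : ℂ | σ₁ ≤ z.re ∧ z.re ≤ σ₂})
    (h₁ : Integrable fun y : ℝ => G ((σ₁ : ℂ) + y * I)) (h₂ : Integrable fun y : ℝ => G ((σ₂ : ℂ) + y * I))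
    (htop : Tendsto (fun T : ℝ => ∫ x in σ₁..σ₂, G ((x : ℂ) + (T : ℂ) * I)) atTop (𝓝 0))
    (hbot : Tendsto (fun T : ℝ => ∫ x in σ₁..σ₂, G ((x : ℂ) + ((-T : ℝ) : ℂ) * I)) atTop (𝓝 0)) :
    ∫ y : ℝ, G ((σ₂ : ℂ) + y * I) = ∫ y : ℝ, G ((σ₁ : ℂ) + y * I) := by
  -- Cauchy on the rectangle with corners `σ₁ − iT`, `σ₂ + iT`
  have hrect : ∀ T : ℝ, (∫ x in σ₁..σ₂, G ((x : ℂ) + ((-T : ℝ) : ℂ) * I)) - (∫ x in σ₁..σ₂, G ((x : ℂ) + (T : ℂ) * I)) +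
      I • (∫ y in (-T)..T, G ((σ₂ : ℂ) + y * I)) - I • (∫ y in (-T)..T, G ((σ₁ : ℂ) + y * I)) = 0 := by
    intro T
    have h := integral_boundary_rect_eq_zero_of_differentiableOn G ((σ₁ : ℂ) + ((-T : ℝ) : ℂ) * I) ((σ₂ : ℂ) + (T : ℂ) * I)
      (hG.mono fun z hz => ?_)
    · have e1 : ((σ₁ : ℂ) + ((-T : ℝ) : ℂ) * I).re = σ₁ := by simp
      have e2 : ((σ₂ : ℂ) + (T : ℂ) * I).re = σ₂ := by simp
      have e3 : ((σ₁ : ℂ) + ((-T : ℝ) : ℂ) * I).im = -T := by simp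
      have e4 : ((σ₂ : ℂ) + (T : ℂ) * I).im = T := by simp
      simp only [e1, e2, e3, e4] at h
      simpa only [ofReal_neg] using h
    · rw [mem_reProdIm] at hz
      have e1 : ((σ₁ : ℂ) + ((-T : ℝ) : ℂ) * I).re = σ₁ := by simp
      have e2 : ((σ₂ : ℂ) + (T : ℂ) * I).re = σ₂ := by simp
      rw [e1, e2, uIcc_of_le hσ] at hz
      exact hz.1
  -- `T → ∞`
  have hv₁ : Tendsto (fun T : ℝ => ∫ y in (-T)..T, G ((σ₁ : ℂ) + y * I)) atTop (𝓝 (∫ y : ℝ, G ((σ₁ : ℂ) + y * I))) :=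
    intervalIntegral_tendsto_integral h₁ tendsto_neg_atTop_atBot tendsto_id
  have hv₂ : Tendsto (fun T : ℝ => ∫ y in (-T)..T, G ((σ₂ : ℂ) + y * I)) atTop (𝓝 (∫ y : ℝ, G ((σ₂ : ℂ) + y * I))) :=
    intervalIntegral_tendsto_integral h₂ tendsto_neg_atTop_atBot tendsto_id
  have hlim : Tendsto (fun T : ℝ => (∫ x in σ₁..σ₂, G ((x : ℂ) + ((-T : ℝ) : ℂ) * I)) - (∫ x in σ₁..σ₂, G ((x : ℂ) + (T : ℂ) * I)) +
      I • (∫ y in (-T)..T, G ((σ₂ : ℂ) + y * I)) - I • (∫ y in (-T)..T, G ((σ₁ : ℂ) + y * I))) atTop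
      (𝓝 (0 - 0 + I • (∫ y : ℝ, G ((σ₂ : ℂ) + y * I)) - I • (∫ y : ℝ, G ((σ₁ : ℂ) + y * I)))) :=
    ((hbot.sub htop).add (hv₂.const_smul I)).sub (hv₁.const_smul I)
  have hzero : Tendsto (fun T : ℝ => (∫ x in σ₁..σ₂, G ((x : ℂ) + ((-T : ℝ) : ℂ) * I)) - (∫ x in σ₁..σ₂, G ((x : ℂ) + (T : ℂ) * I)) +
      I • (∫ y in (-T)..T, G ((σ₂ : ℂ) + y * I)) - I • (∫ y in (-T)..T, G ((σ₁ : ℂ) + y * I))) atTop (𝓝 0) := by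
    simp only [hrect]; exact tendsto_const_nhds
  have heq := tendsto_nhds_unique hlim hzero
  simp only [sub_zero, zero_add, smul_eq_mul] at heq
  have hI : (I : ℂ) ≠ 0 := I_ne_zero
  have h3 : I * ((∫ y : ℝ, G ((σ₂ : ℂ) + y * I)) - ∫ y : ℝ, G ((σ₁ : ℂ) + y * I)) = 0 := by rw [mul_sub]; exact heq
  rcases mul_eq_zero.1 h3 with h | h
  · exact absurd h hI
  · exact sub_eq_zero.1 h

/-- A uniform bound `‖G(x+iy)‖ ≤ K∕y²` (`x ∈ [σ₁,σ₂]`, `|y| ≥ 1`) makes both horizontal integrals tend to `0` as `T → +∞` (`‖∫_{σ₁}^{σ₂}‖ ≤ (σ₂−σ₁)·K∕T²`). [folklore] -/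
theorem tendsto_intervalIntegral_horizontal_of_sq_decay {G : ℂ → ℂ} {σ₁ σ₂ K : ℝ} (hσ : σ₁ ≤ σ₂)
    (hK : ∀ x ∈ Icc σ₁ σ₂, ∀ y : ℝ, 1 ≤ |y| → ‖G ((x : ℂ) + y * I)‖ ≤ K / y ^ 2) :
    Tendsto (fun T : ℝ => ∫ x in σ₁..σ₂, G ((x : ℂ) + (T : ℂ) * I)) atTop (𝓝 0) ∧
      Tendsto (fun T : ℝ => ∫ x in σ₁..σ₂, G ((x : ℂ) + ((-T : ℝ) : ℂ) * I)) atTop (𝓝 0) := by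
  have hK2 : Tendsto (fun T : ℝ => K / T ^ 2 * |σ₂ - σ₁|) atTop (𝓝 0) := by
    have h : Tendsto (fun T : ℝ => K * (T ^ 2)⁻¹ * |σ₂ - σ₁|) atTop (𝓝 (K * 0 * |σ₂ - σ₁|)) :=
      (((tendsto_pow_atTop two_ne_zero).inv_tendsto_atTop).const_mul K).mul_const _
    rw [mul_zero, zero_mul] at h
    simpa only [div_eq_mul_inv] using h
  have hb : ∀ s : ℝ, (s = 1 ∨ s = -1) → ∀ᶠ T : ℝ in atTop, ‖∫ x in σ₁..σ₂, G ((x : ℂ) + ((s * T : ℝ) : ℂ) * I)‖ ≤ K / T ^ 2 * |σ₂ - σ₁| := by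
    intro s hs
    filter_upwards [eventually_ge_atTop (1 : ℝ)] with T hT
    refine intervalIntegral.norm_integral_le_of_norm_le_const fun x hx => ?_
    rw [uIoc_of_le hσ] at hx
    have hy : 1 ≤ |s * T| := by
      rcases hs with rfl | rfl
      · rw [one_mul, abs_of_pos (by linarith)]; exact hT
      · rw [neg_one_mul, abs_neg, abs_of_pos (by linarith)]; exact hT
    have h := hK x ⟨hx.1.le, hx.2⟩ (s * T) hy
    have hs2 : (s * T) ^ 2 = T ^ 2 := by rcases hs with rfl | rfl <;> ring
    rwa [hs2] at h
  refine ⟨squeeze_zero_norm' ?_ hK2, squeeze_zero_norm' ?_ hK2⟩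
  · simpa only [one_mul] using hb 1 (Or.inl rfl)
  · simpa only [neg_one_mul] using hb (-1) (Or.inr rfl)

/-- Continuity plus a bound `‖φ(y)‖ ≤ K∕y²` for `|y| ≥ 1` give integrability on `ℝ` (majorant `C·(1+y²)⁻¹`, the idiom of ★ A `verticalIntegrable_mellin`). [folklore] -/
theorem integrable_of_continuous_of_sq_decay {φ : ℝ → ℂ} (hc : Continuous φ) {K : ℝ} (hK : ∀ y : ℝ, 1 ≤ |y| → ‖φ y‖ ≤ K / y ^ 2) : Integrable φ := by
  obtain ⟨S, hS⟩ := isCompact_Icc.exists_bound_of_continuousOn (hc.continuousOn (s := Icc (-1 : ℝ) 1))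
  have hS0 : 0 ≤ S := (norm_nonneg _).trans (hS 0 ⟨by norm_num, by norm_num⟩)
  set C : ℝ := 2 * max K S with hC
  refine Integrable.mono' (integrable_inv_one_add_sq.const_mul C) hc.aestronglyMeasurable (Eventually.of_forall fun y => ?_)
  by_cases hy : |y| ≤ 1
  · have hy' : y ∈ Icc (-1 : ℝ) 1 := ⟨by linarith [neg_abs_le y], by linarith [le_abs_self y]⟩
    have hy2 : y ^ 2 ≤ 1 := by nlinarith [abs_nonneg y, sq_abs y]
    calc ‖φ y‖ ≤ S := hS y hy'
      _ ≤ max K S := le_max_right _ _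
      _ ≤ C * (1 + y ^ 2)⁻¹ := by
        rw [hC, mul_assoc]
        have h1 : (1 : ℝ) ≤ 2 * (1 + y ^ 2)⁻¹ := by rw [← div_eq_mul_inv, le_div_iff₀ (by positivity)]; linarith
        calc max K S = max K S * 1 := (mul_one _).symm
          _ ≤ max K S * (2 * (1 + y ^ 2)⁻¹) := mul_le_mul_of_nonneg_left h1 (hS0.trans (le_max_right _ _))
          _ = 2 * (max K S * (1 + y ^ 2)⁻¹) := by ring
  · have hy1 : 1 ≤ |y| := (not_le.1 hy).le
    have hy2 : 1 ≤ y ^ 2 := by nlinarith [abs_nonneg y, sq_abs y]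
    calc ‖φ y‖ ≤ K / y ^ 2 := hK y hy1
      _ ≤ max K S / y ^ 2 := div_le_div_of_nonneg_right (le_max_left _ _) (by positivity)
      _ ≤ C * (1 + y ^ 2)⁻¹ := by
        rw [hC, div_eq_mul_inv]
        calc max K S * (y ^ 2)⁻¹ ≤ max K S * (2 * (1 + y ^ 2)⁻¹) := by
              refine mul_le_mul_of_nonneg_left ?_ (hS0.trans (le_max_right _ _))
              rw [inv_eq_one_div, ← div_eq_mul_inv, div_le_div_iff₀ (by positivity) (by positivity)]; linarith
          _ = 2 * max K S * (1 + y ^ 2)⁻¹ := by ring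

/-! ## §3 One simple pole at `z = 1` between the lines: `∫_ℝ F(σ₂+iy) dy = ∫_ℝ F(σ₁+iy) dy + 2π·Res_{z=1}F` -/

/-- **CONTOUR SHIFT ACROSS A SIMPLE POLE AT `z = 1`.**  `−1 < σ₁ < 1 < σ₂`; `U` open containing the closed strip `{σ₁ ≤ Re z ≤ σ₂}`; `F` complex-differentiable on `U ∖ {1}` with
`(z−1)·F(z) → ρ` as `z → 1` (`z ≠ 1`); `y ↦ F(σᵢ+iy)` integrable (`i = 1,2`); `‖F(x+iy)‖ ≤ K∕y²` for `x ∈ [σ₁,σ₂]`, `|y| ≥ 1`.  Then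
**`∫_ℝ F(σ₂+iy) dy = ∫_ℝ F(σ₁+iy) dy + 2π·ρ`**, i.e. `(2π)⁻¹∫_ℝ F(σ₂+iy) dy = (2π)⁻¹∫_ℝ F(σ₁+iy) dy + Res_{z=1} F`.  Proof: `h := (z−1)F` extended by `ρ` at `1` is holomorphic on
`U' = U ∩ {Re > −1}` (removable singularity), `N := h − 2ρ∕(z+1)` vanishes at `1`, `G := dslope N 1` is holomorphic on `U'` and equals `F − ρ·k`, `k(z) = 2∕((z−1)(z+1))`, off `z = 1`;
§2 shifts `G` (decay `(K + 2‖ρ‖)∕y²`), §1 gives `∫k(σ₂+iy) = 0`, `∫k(σ₁+iy) = −2π`. [cite: Titchmarsh1939, §3.1, §3.12] [cite: MoeglinWaldspurger1995, II.2.1] -/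
theorem integral_vertical_eq_integral_vertical_add_residue {F : ℂ → ℂ} {σ₁ σ₂ : ℝ} (hσ₁ : -1 < σ₁) (hσ₁' : σ₁ < 1) (hσ₂ : 1 < σ₂)
    {U : Set ℂ} (hUo : IsOpen U) (hUs : {z : ℂ | σ₁ ≤ z.re ∧ z.re ≤ σ₂} ⊆ U) (hF : DifferentiableOn ℂ F (U \ {1}))
    {ρ : ℂ} (hρ : Tendsto (fun z : ℂ => (z - 1) * F z) (𝓝[≠] 1) (𝓝 ρ))
    (h₁ : Integrable fun y : ℝ => F ((σ₁ : ℂ) + y * I)) (h₂ : Integrable fun y : ℝ => F ((σ₂ : ℂ) + y * I))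
    {K : ℝ} (hK : ∀ x ∈ Icc σ₁ σ₂, ∀ y : ℝ, 1 ≤ |y| → ‖F ((x : ℂ) + y * I)‖ ≤ K / y ^ 2) :
    ∫ y : ℝ, F ((σ₂ : ℂ) + y * I) = (∫ y : ℝ, F ((σ₁ : ℂ) + y * I)) + 2 * π * ρ := by
  classical
  -- the open set `U' = U ∩ {Re z > −1}` ⊇ strip, `1 ∈ U'`, `z + 1 ≠ 0` on `U'`
  set U' : Set ℂ := U ∩ {z : ℂ | -1 < z.re} with hU'
  have hU'o : IsOpen U' := hUo.inter (isOpen_lt continuous_const continuous_re)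
  have h1U' : (1 : ℂ) ∈ U' := ⟨hUs ⟨by simp; linarith, by simp; linarith⟩, by simp⟩
  have hU'1 : U' ∈ 𝓝 (1 : ℂ) := hU'o.mem_nhds h1U'
  have hne1 : ∀ z ∈ U', z + 1 ≠ 0 := fun z hz h => by
    have h' := congrArg Complex.re h
    simp only [add_re, one_re, zero_re] at h'
    have := hz.2; simp only [mem_setOf_eq] at this; linarith
  -- `h := (z−1)F(z)` extended by `ρ` at `1`: holomorphic on `U'`
  set h : ℂ → ℂ := Function.update (fun z => (z - 1) * F z) 1 ρ with hh
  have hh_ne : ∀ z, z ≠ 1 → h z = (z - 1) * F z := fun z hz => by rw [hh, Function.update_of_ne hz]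
  have hh1 : h 1 = ρ := by rw [hh, Function.update_self]
  have hhd : DifferentiableOn ℂ h U' := by
    refine (differentiableOn_compl_singleton_and_continuousAt_iff hU'1).1 ⟨?_, continuousAt_update_same.2 hρ⟩
    have hd : DifferentiableOn ℂ (fun z => (z - 1) * F z) (U' \ {1}) :=
      ((differentiableOn_id.sub (differentiableOn_const _)).mul (hF.mono fun z hz => ⟨hz.1.1, hz.2⟩))
    exact hd.congr fun z hz => hh_ne z hz.2
  -- `N := h − 2ρ∕(z+1)`, `N(1) = 0`; `G := dslope N 1` holomorphic on `U'`
  set N : ℂ → ℂ := fun z => h z - 2 * ρ * (z + 1)⁻¹ with hN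
  have hNd : DifferentiableOn ℂ N U' := hhd.sub ((differentiableOn_const _).mul ((differentiableOn_id.add (differentiableOn_const _)).inv hne1))
  have hN1 : N 1 = 0 := by
    simp only [hN, hh1]
    ring
  set G : ℂ → ℂ := dslope N 1 with hG
  have hGd : DifferentiableOn ℂ G U' := (differentiableOn_dslope hU'1).2 hNd
  -- off `z = 1` (and `z ≠ −1`): `G = F − ρ·k`
  have hGF : ∀ z : ℂ, z ≠ 1 → z + 1 ≠ 0 → G z = F z - ρ * (2 * ((z - 1) * (z + 1))⁻¹) := by
    intro z hz hz'
    have hz1 : z - 1 ≠ 0 := sub_ne_zero.2 hz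
    rw [hG, dslope_of_ne _ hz, slope_def_field, hN1, sub_zero]
    simp only [hN, hh_ne z hz]
    field_simp
  -- the two lines avoid `±1`
  have hline : ∀ {σ : ℝ}, σ ≠ 1 → -1 < σ → ∀ y : ℝ, G ((σ : ℂ) + y * I) = F ((σ : ℂ) + y * I) - ρ * (2 * ((((σ : ℂ) + y * I) - 1) * (((σ : ℂ) + y * I) + 1))⁻¹) := by
    intro σ hσ hσm y
    refine hGF _ (fun h' => hσ ?_) (fun h' => ?_)
    · have := congrArg Complex.re h'; simpa using this
    · have := congrArg Complex.re h'; simp at this; linarith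
  have hG₁ : (fun y : ℝ => G ((σ₁ : ℂ) + y * I)) = fun y : ℝ => F ((σ₁ : ℂ) + y * I) - ρ * (2 * ((((σ₁ : ℂ) + y * I) - 1) * (((σ₁ : ℂ) + y * I) + 1))⁻¹) :=
    funext (hline hσ₁'.ne hσ₁)
  have hG₂ : (fun y : ℝ => G ((σ₂ : ℂ) + y * I)) = fun y : ℝ => F ((σ₂ : ℂ) + y * I) - ρ * (2 * ((((σ₂ : ℂ) + y * I) - 1) * (((σ₂ : ℂ) + y * I) + 1))⁻¹) :=
    funext (hline hσ₂.ne' (by linarith))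
  have hk₁ := integrable_kernel_vertical hσ₁'.ne hσ₁.ne'
  have hk₂ := integrable_kernel_vertical hσ₂.ne' (by linarith : σ₂ ≠ -1)
  have hGi₁ : Integrable fun y : ℝ => G ((σ₁ : ℂ) + y * I) := by rw [hG₁]; exact h₁.sub (hk₁.const_mul ρ)
  have hGi₂ : Integrable fun y : ℝ => G ((σ₂ : ℂ) + y * I) := by rw [hG₂]; exact h₂.sub (hk₂.const_mul ρ)
  -- uniform decay of `G` on the strip: `(K + 2‖ρ‖)∕y²`
  have hGK : ∀ x ∈ Icc σ₁ σ₂, ∀ y : ℝ, 1 ≤ |y| → ‖G ((x : ℂ) + y * I)‖ ≤ (K + 2 * ‖ρ‖) / y ^ 2 := by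
    intro x hx y hy
    have hy0 : y ≠ 0 := fun h0 => by rw [h0, abs_zero] at hy; linarith
    have hz1 : (x : ℂ) + y * I ≠ 1 := fun h' => hy0 (by simpa using congrArg Complex.im h')
    have hz2 : (x : ℂ) + y * I + 1 ≠ 0 := fun h' => hy0 (by simpa using congrArg Complex.im h')
    rw [hGF _ hz1 hz2]
    have hi1 : |y| ≤ ‖(x : ℂ) + y * I - 1‖ := by
      have h := abs_im_le_norm ((x : ℂ) + y * I - 1); simpa using h
    have hi2 : |y| ≤ ‖(x : ℂ) + y * I + 1‖ := by
      have h := abs_im_le_norm ((x : ℂ) + y * I + 1); simpa using h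
    have hy2 : y ^ 2 = |y| * |y| := by rw [← sq, sq_abs]
    have hk : ‖ρ * (2 * ((((x : ℂ) + y * I) - 1) * (((x : ℂ) + y * I) + 1))⁻¹)‖ ≤ 2 * ‖ρ‖ / y ^ 2 := by
      rw [norm_mul, norm_mul, norm_inv, norm_mul, RCLike.norm_ofNat, hy2]
      have hpos : 0 < |y| * |y| := by positivity
      calc ‖ρ‖ * (2 * (‖(x : ℂ) + y * I - 1‖ * ‖(x : ℂ) + y * I + 1‖)⁻¹) ≤ ‖ρ‖ * (2 * (|y| * |y|)⁻¹) :=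
            mul_le_mul_of_nonneg_left (mul_le_mul_of_nonneg_left (inv_anti₀ hpos (mul_le_mul hi1 hi2 (abs_nonneg _) (norm_nonneg _))) (by norm_num)) (norm_nonneg _)
        _ = 2 * ‖ρ‖ / (|y| * |y|) := by ring
    calc ‖F ((x : ℂ) + y * I) - ρ * (2 * ((((x : ℂ) + y * I) - 1) * (((x : ℂ) + y * I) + 1))⁻¹)‖
        ≤ ‖F ((x : ℂ) + y * I)‖ + ‖ρ * (2 * ((((x : ℂ) + y * I) - 1) * (((x : ℂ) + y * I) + 1))⁻¹)‖ := norm_sub_le _ _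
      _ ≤ K / y ^ 2 + 2 * ‖ρ‖ / y ^ 2 := add_le_add (hK x hx y hy) hk
      _ = (K + 2 * ‖ρ‖) / y ^ 2 := by ring
  obtain ⟨htop, hbot⟩ := tendsto_intervalIntegral_horizontal_of_sq_decay (le_of_lt (hσ₁'.trans hσ₂)) hGK
  -- §2 for `G`
  have hshift := integral_vertical_eq_of_differentiableOn (le_of_lt (hσ₁'.trans hσ₂)) (hGd.mono fun z hz => ⟨hUs hz, lt_of_lt_of_le hσ₁ hz.1⟩) hGi₁ hGi₂ htop hbot
  rw [hG₁, hG₂, integral_sub h₂ (hk₂.const_mul ρ), integral_sub h₁ (hk₁.const_mul ρ), MeasureTheory.integral_const_mul ρ, MeasureTheory.integral_const_mul ρ,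
    integral_kernel_vertical_of_one_lt hσ₂, integral_kernel_vertical_of_lt_one hσ₁ hσ₁'] at hshift
  have h3 : ∫ y : ℝ, F ((σ₂ : ℂ) + y * I) = (∫ y : ℝ, F ((σ₁ : ℂ) + y * I)) - ρ * (-2 * π) := by
    rw [mul_zero, sub_zero] at hshift; exact hshift
  rw [h3]; ring

end Summit.HodgeConjecture.HodgeConjecture.Cruxes.H413.K2E1VerticalLineContourShift

end
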